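import Summits.HubbardSuperconductivity.HubbardSuperconductivity.Theorems.AnisotropyChordDoobJohnsonChordPlan
import Summits.HubbardSuperconductivity.HubbardSuperconductivity.Theorems.AnisotropyChordCondensateSlabKappaPos
import Summits.HubbardSuperconductivity.HubbardSuperconductivity.Theorems.AnisotropyChordVirialMonotone
import Literature.MathematicalPhysics.QuantumLattice.HardCoreBosonHalfFillingOptimal
import Literature.Barriers.AtomisticToContinuum.HalfFillingReflectionPositivity

/-!
# Route `AnisotropyChord`, crux `ChordXY` (stmt-HubbardSuperconductivity-8146): the NEAREST-NEIGHBOUR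
# SHELL of the chord is a theorem — `nnChordXY` (rung; lead-8146-chordxy g2, strengthen-lens g6 §4)

Vocabulary of `…Theorems.AnisotropyChordDoobJohnsonChordDefs` (`Config`, `Hxxz M Δ = H_M(Δ)`, `IsGS`).
Write `T = H_M(0) = -Σ_{xy∈E}(SˣSˣ + SʸSʸ)` (the XY Hamiltonian of the `M × M` torus, `E` its edge set,
`|E| = (torusGraph 2 M).edgeFinset.card`), `P = H_M(1) - H_M(0) = -Σ_{xy∈E} SᶻSᶻ` (the Ising direction of
the pencil `H_M(u) = T + u·P`), and `E_M(u)` for the `S^z_tot = 0` sector energy.  The crux `ChordXY` asks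
`(1+u)·Λ(ψ₀) ≤ Λ(ψ)` for the FULL pair field `Λ = Re⟨·, S⁺_tot S⁻_tot ·⟩ = N/2 + 2·(-Re⟨·,T·⟩) + Λ_far`
(on-site shell + nearest-neighbour shell + the far shell).  This file proves the chord FOR THE
NEAREST-NEIGHBOUR SHELL, on every even torus and every `u ∈ [-1, 0]`:

* `nnChordXY` — for normalised sector ground states `ψ₀` of `H_M(0)` and `ψ` of `H_M(u)`,
  `(1+u)·(-Re⟨ψ₀, T ψ₀⟩) ≤ -Re⟨ψ, T ψ⟩`, i.e. the nearest-neighbour transverse correlation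
  `Σ_E Re⟨SˣSˣ + SʸSʸ⟩` of the sector ground state at anisotropy `u` is at least `(1+u)` times its
  value at the XY point.

Proof (three variational one-liners, strengthen lens g6 `CENSUS-strengthen-g6.md` §4):
(i) `E_M(u) ≤ Re⟨ψ₀, H_M(u)ψ₀⟩ = E_M(0) + u·Re⟨ψ₀,Pψ₀⟩` (`ψ₀` as a trial state at `u`,
`sectorEnergy_le_re_form`); (ii) `Re⟨ψ, P ψ⟩ ≤ |E|/4` (`re_pencil_form_le`: every Ising bond term is
`≥ -¼`); (iii) `E_M(0) ≤ -|E|/4` (`sectorEnergy_zero_le`: the sector-`0` energy of the XY torus is its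
ground energy — hard-core bosons at half filling, `HardCoreBoson.lowestEnergyInSector_zero_eq_groundEnergy`
— and the planar product state has energy `-|E|/4`, Kennedy–Lieb–Shastry's variational remark
`xyTorus_trialEnergy`); (iv) `Re⟨ψ₀, H_M(1)ψ₀⟩ ≥ E_M(1) = -|E|/4` (`sectorEnergy_one_eq`: the uniform
half-filled superposition is a non-negative eigenvector of the isotropic ferromagnet `H_M(1)` with
eigenvalue `-|E|/4`, `hxxz_one_mulVec_halfFilledIndicator`, hence — pairing it with the positive Perron
ground state of the sector, `sectorPerron_condensate` — `E_M(1) = -|E|/4`).  Then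
`-Re⟨ψ,Tψ⟩ = -E_M(u) + u·Re⟨ψ,Pψ⟩ ≥ -E_M(0) - u·Re⟨ψ₀,Pψ₀⟩ + u·|E|/4 ≥ -(1+u)·E_M(0)` because
`Re⟨ψ₀,Pψ₀⟩ ≥ -|E|/4 - E_M(0)` by (iv) and `E_M(0) ≤ -|E|/4` by (iii).

HONEST LABEL (g6's): graph-blind (nothing `d = 2`-specific is used), inside the trivial regime, NOT a
mechanism for the crux and not a registered stub: the nearest-neighbour shell is `O(N)` out of `Λ = O(N²)`
and has the MOST slack; the far shell `Λ_far` carries the whole difficulty of `ChordXY`.  It is recorded as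
the first landed positive all-`(M,u)` statement bearing on stmt-8146 besides the near-AF windows
(`stub_logSlopeBound_near_AF`, `stub_frozenFieldChord_near_AF`).  Nothing here proves `stub_logSlopeBound`,
`stub_frozenFieldChord`, `ChordXY`, or any summit statement; superconductivity in the Hubbard model is NOT
advanced.  Sources: T. Kennedy, E. H. Lieb, B. S. Shastry, Phys. Rev. Lett. 61 (1988) 2582 (after eq. (8));
H. Tasaki, *Physics and Mathematics of Quantum Many-Body Systems* (2020) §2.4, App. A; M. Aizenman,
E. H. Lieb, R. Seiringer, J. P. Solovej, J. Yngvason, Phys. Rev. A 70 (2004) 023612, App. A.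
No definition is introduced.
-/

set_option linter.dupNamespace false

noncomputable section

namespace Summit.HubbardSuperconductivity.HubbardSuperconductivity.Theorems.AnisotropyChord.DoobJohnsonChord

open Matrix Complex Finset
open Literature.MathematicalPhysics.QuantumLattice Literature.Probability.LatticeModels

variable (M : ℕ) [NeZero M]

/-! ### Complex bookkeeping -/

/-- `Re (z̄ · (r z)) = r |z|²` for real `r`. [bookkeeping] -/
theorem re_star_mul_ofReal_mul (r : ℝ) (z : ℂ) : (star z * ((r : ℂ) * z)).re = r * ‖z‖ ^ 2 := by
  have h : star z * ((r : ℂ) * z) = (r : ℂ) * ((starRingEnd ℂ) z * z) := by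
    rw [Complex.star_def]
    ring
  rw [h, Complex.conj_mul', ← Complex.ofReal_pow, ← Complex.ofReal_mul, Complex.ofReal_re]

/-! ### (ii) The Ising direction of the pencil is bounded by `|E|/4` -/

/-- **`Re⟨ψ, (H_M(1) - H_M(0)) ψ⟩ ≤ (|E|/4)·⟨ψ,ψ⟩`**: the Ising direction `P = -Σ_E SᶻSᶻ` of the XXZ pencil
is the diagonal matrix `-Z(σ)` (`xxzPencil_mulVec_apply`) and every bond term of `Z` is `≥ -¼`
(`edge_term_ge`). Tasaki (2020) §2.4. [folklore] -/
theorem re_pencil_form_le (ψ : Config M → ℂ) :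
    (star ψ ⬝ᵥ ((Hxxz M 1 - Hxxz M 0) *ᵥ ψ)).re ≤
      ((torusGraph 2 M).edgeFinset.card : ℝ) / 4 * (star ψ ⬝ᵥ ψ).re := by
  -- `Z(σ) ≥ -|E|/4`
  have hZ : ∀ σ : Config M, -(((torusGraph 2 M).edgeFinset.card : ℝ) / 4) ≤
      ∑ e ∈ (torusGraph 2 M).edgeFinset, Sym2.lift ⟨fun x y =>
        ((1 : ℝ) / 2 - (σ x : ℕ)) * ((1 : ℝ) / 2 - (σ y : ℕ)), fun _ _ => mul_comm _ _⟩ e := by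
    intro σ
    have h : ∀ e ∈ (torusGraph 2 M).edgeFinset, -(1 / 4 : ℝ) ≤ Sym2.lift ⟨fun x y =>
        ((1 : ℝ) / 2 - (σ x : ℕ)) * ((1 : ℝ) / 2 - (σ y : ℕ)), fun _ _ => mul_comm _ _⟩ e := by
      intro e _
      induction e using Sym2.ind with
      | h x y =>
        rw [Sym2.lift_mk]
        exact edge_term_ge M σ x y
    calc -(((torusGraph 2 M).edgeFinset.card : ℝ) / 4)
        = ∑ _e ∈ (torusGraph 2 M).edgeFinset, (-(1 / 4 : ℝ)) := by
          rw [Finset.sum_const, nsmul_eq_mul]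
          ring
      _ ≤ _ := Finset.sum_le_sum h
  rw [dotProduct, Complex.re_sum, dotProduct, Complex.re_sum, Finset.mul_sum]
  refine Finset.sum_le_sum fun σ _ => ?_
  -- `Re (z̄ z) = |z|²` (the landed `re_star_mul_self_eq_norm_sq`, re-derived to keep the imports light)
  have hself : (star (ψ σ) * ψ σ).re = ‖ψ σ‖ ^ 2 := by
    have h := re_star_mul_ofReal_mul 1 (ψ σ)
    rwa [Complex.ofReal_one, one_mul, one_mul] at h
  rw [Pi.star_apply, hself]
  unfold Hxxz
  rw [xxzPencil_mulVec_apply, ← Complex.ofReal_neg, re_star_mul_ofReal_mul]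
  have hn : 0 ≤ ‖ψ σ‖ ^ 2 := by positivity
  nlinarith [hZ σ, hn]

/-! ### (iii) The sector energy of the XY torus is at most `-|E|/4` -/

/-- **`E_M(0) ≤ -|E|/4`**: the `S^z_tot = 0` sector energy of the XY torus `H_M(0)` equals its ground energy
(hard-core bosons realise the ground energy at half filling, Aizenman–Lieb–Seiringer–Solovej–Yngvason
(2004) App. A, `HardCoreBoson.lowestEnergyInSector_zero_eq_groundEnergy`), which is at most the energy
`-S²|E| = -|E|/4` of the planar product state (Kennedy–Lieb–Shastry (1988), after eq. (8),
`xyTorus_trialEnergy`). [folklore] -/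
theorem sectorEnergy_zero_le (hM : Even M) :
    lowestEnergyInSector 1 (Hxxz M 0) 0 ≤ -(((torusGraph 2 M).edgeFinset.card : ℝ) / 4) := by
  -- sector-0 energy = ground energy
  have hE : lowestEnergyInSector 1 (Hxxz M 0) 0 = (xyTorus 2 M 1).groundEnergy := by
    have h := HardCoreBoson.lowestEnergyInSector_zero_eq_groundEnergy (d := 2) (L := M) two_pos hM 0
    rw [Literature.Barriers.AtomisticToContinuum.BoseGas.hardCoreLatticeGas_zero] at h
    exact h
  rw [hE]
  -- the Kennedy–Lieb–Shastry trial state: all spins along the `1`-axis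
  have hHerm : (xyTorus 2 M 1).IsHermitian := xyTorus_isHermitian 2 M 1
  obtain ⟨V, hV, hV', hVz, -, hVy⟩ := exists_unitary_conj_spinZ_eq_spinX (n := 1)
  set W : Op (TorusSite 2 M) (1 + 1) := productOp (fun _ : TorusSite 2 M => Vᴴ) with hW
  have hWW : W * Wᴴ = 1 :=
    productOp_mul_conjTranspose fun _ => by rw [conjTranspose_conjTranspose, hV']
  set v : TensorIndex (TorusSite 2 M) (1 + 1) → ℂ := Pi.single (fun _ => 0) 1 with hv
  have hstar : star v = v := by rw [hv, ← Pi.single_star, star_one]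
  have hψ : star (Wᴴ *ᵥ v) ⬝ᵥ (Wᴴ *ᵥ v) = 1 := by
    rw [star_mulVec, conjTranspose_conjTranspose, ← dotProduct_mulVec, mulVec_mulVec, hWW,
      one_mulVec, hstar, hv, single_dotProduct, Pi.single_eq_same, one_mul]
  have h2 := Matrix.groundEnergy_le_rayleigh_holds hHerm (Wᴴ *ᵥ v) hψ
  rw [star_mulVec, conjTranspose_conjTranspose, ← dotProduct_mulVec, mulVec_mulVec,
    mulVec_mulVec, hstar, hv, single_dotProduct, one_mul, mulVec_single_one, Matrix.col_apply, hW,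
    xyTorus_trialEnergy M 1 hV hV' hVz hVy, Complex.neg_re] at h2
  have hval : ((((1 : ℕ) : ℂ) / 2) ^ 2 * (((torusGraph 2 M).edgeFinset.card : ℕ) : ℂ)).re =
      ((torusGraph 2 M).edgeFinset.card : ℝ) / 4 := by
    have h : (((1 : ℕ) : ℂ) / 2) ^ 2 * (((torusGraph 2 M).edgeFinset.card : ℕ) : ℂ) =
        (((((torusGraph 2 M).edgeFinset.card : ℝ) / 4 : ℝ)) : ℂ) := by
      push_cast
      ring
    rw [h, Complex.ofReal_re]
  rw [hval] at h2
  exact h2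

/-! ### (iv) The sector energy at the ferromagnetic point is `-|E|/4` -/

/-- **The uniform half-filled superposition is an eigenvector of the isotropic ferromagnet `H_M(1)` with
eigenvalue `-|E|/4`.**  By the hopping formula (`xxz_mulVec_apply`), `(H_M(1)𝟙_{hf})(σ) = -Z(σ) - ½k(σ)` on a
half-filled `σ` (`k(σ)` = number of antiparallel edges, each hop stays half filled), and
`Z(σ) = |E|/4 - ½k(σ)` bond by bond; off the half-filled configurations both sides vanish.
Tasaki (2020) §2.4 (the ferromagnetic multiplet). [folklore] -/
theorem hxxz_one_mulVec_halfFilledIndicator :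
    Hxxz M 1 *ᵥ (fun σ : Config M => if (∑ z, (σ z : ℕ)) = M ^ 2 / 2 then (1 : ℂ) else 0) =
      ((-(((torusGraph 2 M).edgeFinset.card : ℝ) / 4) : ℝ) : ℂ) •
        (fun σ : Config M => if (∑ z, (σ z : ℕ)) = M ^ 2 / 2 then (1 : ℂ) else 0) := by
  funext σ
  rw [Pi.smul_apply, smul_eq_mul]
  unfold Hxxz
  rw [OneMagnon.xxz_mulVec_apply]
  -- a swap of two sites preserves the weight
  have hwt : ∀ x y : TorusSite 2 M, (∑ z, (((σ ∘ Equiv.swap x y) z : Fin 2) : ℕ)) = ∑ z, (σ z : ℕ) :=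
    fun x y => Equiv.sum_comp (Equiv.swap x y) (fun z => ((σ z : Fin 2) : ℕ))
  have fin_two : ∀ t : Fin 2, t = 0 ∨ t = 1 := by decide
  by_cases hσ : (∑ z, (σ z : ℕ)) = M ^ 2 / 2
  · rw [if_pos hσ, mul_one, mul_one, one_mul, Complex.ofReal_sum, Finset.mul_sum, ← Finset.sum_neg_distrib,
      ← Finset.sum_sub_distrib]
    have hterm : ∀ e ∈ (torusGraph 2 M).edgeFinset,
        -((Sym2.lift ⟨fun x y => ((1 : ℝ) / 2 - (σ x : ℕ)) * ((1 : ℝ) / 2 - (σ y : ℕ)),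
            fun _ _ => mul_comm _ _⟩ e : ℝ) : ℂ) -
          (1 / 2 : ℂ) * Sym2.lift ⟨fun x y => if σ x ≠ σ y then
            (fun τ : Config M => if (∑ z, (τ z : ℕ)) = M ^ 2 / 2 then (1 : ℂ) else 0) (σ ∘ Equiv.swap x y)
            else 0, fun x y => by simp only [ne_comm, Equiv.swap_comm]⟩ e
          = -(1 / 4 : ℂ) := by
      intro e _
      induction e using Sym2.ind with
      | h x y =>
        simp only [Sym2.lift_mk, hwt x y, hσ, if_true]
        rcases fin_two (σ x) with hx | hx <;> rcases fin_two (σ y) with hy | hy <;>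
          · simp [hx, hy]
            norm_num
    rw [Finset.sum_congr rfl hterm, Finset.sum_const, nsmul_eq_mul]
    push_cast
    ring
  · rw [if_neg hσ, mul_zero, mul_zero, zero_sub, neg_eq_zero]
    refine mul_eq_zero_of_right _ (Finset.sum_eq_zero fun e _ => ?_)
    induction e using Sym2.ind with
    | h x y =>
      simp only [Sym2.lift_mk, hwt x y, hσ, if_false, ite_self]

/-- **`E_M(1) = -|E|/4`**: the `S^z_tot = 0` sector energy of the isotropic ferromagnet `H_M(1) = -Σ_E 𝐒_x·𝐒_y`
on the even torus is the energy of the ferromagnetic multiplet.  The uniform half-filled superposition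
`𝟙_{hf}` is a non-negative eigenvector with eigenvalue `-|E|/4` (`hxxz_one_mulVec_halfFilledIndicator`);
pairing the eigen-equation with the positive Perron ground state `ψr` of the sector
(`sectorPerron_condensate`; `⟨ψr, 𝟙_{hf}⟩ > 0`) and using hermiticity gives `E_M(1)·⟨ψr,𝟙⟩ = (-|E|/4)·⟨ψr,𝟙⟩`.
Tasaki (2020) §2.4; Lieb–Mattis (1962). [folklore] -/
theorem sectorEnergy_one_eq (hM : Even M) :
    lowestEnergyInSector 1 (Hxxz M 1) 0 = -(((torusGraph 2 M).edgeFinset.card : ℝ) / 4) := by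
  set φ : Config M → ℂ := fun σ => if (∑ z, (σ z : ℕ)) = M ^ 2 / 2 then (1 : ℂ) else 0 with hφ
  set c : ℝ := -(((torusGraph 2 M).edgeFinset.card : ℝ) / 4) with hc
  have hφK : φ ∈ spinZSector (Λ := TorusSite 2 M) 1 0 := by
    rw [mem_halfFilled_iff M hM]
    intro σ hσ
    simp [hφ, hσ]
  have hHφ : Hxxz M 1 *ᵥ φ = ((c : ℝ) : ℂ) • φ := hxxz_one_mulVec_halfFilledIndicator M
  -- the positive Perron state of the sector at `Δ = 1`
  obtain ⟨ψr, hnn, ⟨-, -, heig⟩, hsupp, -⟩ := sectorPerron_condensate M hM 1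
  -- `⟨ψr, φ⟩ ≠ 0`
  have hpos : ∀ σ : Config M, (∑ z, (σ z : ℕ)) = M ^ 2 / 2 → 0 < ψr σ := fun σ hσ =>
    hsupp φ hφK σ (by simp [hφ, hσ])
  have hre : (star (ofReal M ψr) ⬝ᵥ φ).re =
      ∑ σ, (if (∑ z, (σ z : ℕ)) = M ^ 2 / 2 then ψr σ else 0) := by
    rw [dotProduct, Complex.re_sum]
    refine Finset.sum_congr rfl fun σ _ => ?_
    by_cases hσ : (∑ z, (σ z : ℕ)) = M ^ 2 / 2
    · simp [hφ, hσ, ofReal]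
    · simp [hφ, hσ]
  have hs : star (ofReal M ψr) ⬝ᵥ φ ≠ 0 := by
    obtain ⟨σ₀, hσ₀⟩ := exists_halfFilled M
    intro h0
    have hge : ψr σ₀ ≤ ∑ σ, (if (∑ z, (σ z : ℕ)) = M ^ 2 / 2 then ψr σ else 0) := by
      have h := Finset.single_le_sum
        (f := fun σ : Config M => if (∑ z, (σ z : ℕ)) = M ^ 2 / 2 then ψr σ else 0)
        (fun σ _ => by
          show (0 : ℝ) ≤ if (∑ z, (σ z : ℕ)) = M ^ 2 / 2 then ψr σ else 0
          split_ifs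
          · exact hnn σ
          · exact le_rfl)
        (Finset.mem_univ σ₀)
      simpa only [hσ₀, if_true] using h
    have hzero : (star (ofReal M ψr) ⬝ᵥ φ).re = 0 := by rw [h0, Complex.zero_re]
    linarith [hpos σ₀ hσ₀]
  -- pair the two eigen-equations
  have hH : (Hxxz M 1).IsHermitian := xxzHamiltonian_isHermitian 1 (torusGraph 2 M) (-1) 1
  have h1 : star (ofReal M ψr) ⬝ᵥ (Hxxz M 1 *ᵥ φ) = ((c : ℝ) : ℂ) * (star (ofReal M ψr) ⬝ᵥ φ) := by
    rw [hHφ, dotProduct_smul, smul_eq_mul]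
  have h2 : star (ofReal M ψr) ⬝ᵥ (Hxxz M 1 *ᵥ φ) =
      ((lowestEnergyInSector 1 (Hxxz M 1) 0 : ℝ) : ℂ) * (star (ofReal M ψr) ⬝ᵥ φ) := by
    have hsw : star (ofReal M ψr) ⬝ᵥ (Hxxz M 1 *ᵥ φ) = star (Hxxz M 1 *ᵥ ofReal M ψr) ⬝ᵥ φ := by
      rw [star_mulVec, hH.eq, dotProduct_mulVec]
    rw [hsw, heig, star_smul, Complex.star_def, Complex.conj_ofReal, smul_dotProduct, smul_eq_mul]
  have h3 : ((c : ℝ) : ℂ) = ((lowestEnergyInSector 1 (Hxxz M 1) 0 : ℝ) : ℂ) :=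
    mul_right_cancel₀ hs (h1.symm.trans h2)
  exact (Complex.ofReal_injective h3).symm

/-- **`Re⟨ψ, H_M(1) ψ⟩ ≥ -|E|/4` for every normalised vector of the `S^z_tot = 0` sector** (variational
principle at the ferromagnetic point, `sectorEnergy_one_eq`). [folklore] -/
theorem re_form_hxxz_one_ge (hM : Even M) {ψ : Config M → ℂ}
    (hK : ψ ∈ spinZSector (Λ := TorusSite 2 M) 1 0) (h1 : star ψ ⬝ᵥ ψ = 1) :
    -(((torusGraph 2 M).edgeFinset.card : ℝ) / 4) ≤ (star ψ ⬝ᵥ (Hxxz M 1 *ᵥ ψ)).re := by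
  have h := sectorEnergy_le_re_form 1 (torusGraph 2 M) (J := -1) (Δ := 1) hK h1
  rw [← sectorEnergy_one_eq M hM]
  exact h

/-! ### The rung: the nearest-neighbour shell of `ChordXY` -/

/-- **`NNChordXY` — the nearest-neighbour shell of the crux chord (rung; strengthen lens g6 §4).**  For every
even side `M`, every `u ∈ [-1, 0]`, every normalised `S^z_tot = 0` sector ground state `ψ₀` of the XY
torus `H_M(0)` and `ψ` of `H_M(u)`:
`(1+u) · (-Re⟨ψ₀, H_M(0) ψ₀⟩) ≤ -Re⟨ψ, H_M(0) ψ⟩`,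
i.e. the nearest-neighbour transverse correlation `-⟨T⟩ = Σ_E Re⟨SˣSˣ+SʸSʸ⟩` (the nearest-neighbour shell of
`Λ = ⟨S⁺_tot S⁻_tot⟩ = N/2 - 2⟨T⟩ + Λ_far`) obeys the chord inequality of `ChordXY`.  Variational: `ψ₀` as a
trial state at `u`, `Re⟨ψ,Pψ⟩ ≤ |E|/4`, `E_M(0) ≤ -|E|/4`, `Re⟨ψ₀,H_M(1)ψ₀⟩ ≥ -|E|/4`.  Graph-blind and NOT a
mechanism for the crux (the far shell carries the difficulty); nothing here proves `ChordXY`.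
Kennedy–Lieb–Shastry (1988); Tasaki (2020) §2.4, App. A. [folklore] -/
theorem nnChordXY (hM : Even M) :
    ∀ u ∈ Set.Icc (-1:ℝ) 0, ∀ ψ₀ ψ : Config M → ℂ, IsGS M 0 ψ₀ → IsGS M u ψ →
      (1 + u) * (-(star ψ₀ ⬝ᵥ (Hxxz M 0 *ᵥ ψ₀))).re ≤ (-(star ψ ⬝ᵥ (Hxxz M 0 *ᵥ ψ))).re := by
  intro u hu ψ₀ ψ h₀ h
  obtain ⟨h₀m, h₀n, h₀e⟩ := h₀
  obtain ⟨hm, hn, he⟩ := h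
  -- the four quadratic forms
  set Nb : ℝ := ((torusGraph 2 M).edgeFinset.card : ℝ) with hNb
  set t₀ : ℝ := (star ψ₀ ⬝ᵥ (Hxxz M 0 *ᵥ ψ₀)).re with ht₀
  set p₀ : ℝ := (star ψ₀ ⬝ᵥ ((Hxxz M 1 - Hxxz M 0) *ᵥ ψ₀)).re with hp₀
  set tu : ℝ := (star ψ ⬝ᵥ (Hxxz M 0 *ᵥ ψ)).re with htu
  set pu : ℝ := (star ψ ⬝ᵥ ((Hxxz M 1 - Hxxz M 0) *ᵥ ψ)).re with hpu
  -- `t₀ = E_M(0)`, `Re⟨ψ, H_M(u)ψ⟩ = E_M(u)`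
  have hE₀ : (star ψ₀ ⬝ᵥ (Hxxz M 0 *ᵥ ψ₀)).re = lowestEnergyInSector 1 (Hxxz M 0) 0 :=
    re_form_of_sectorGS 1 (torusGraph 2 M) h₀n h₀e
  have hEu : (star ψ ⬝ᵥ (Hxxz M u *ᵥ ψ)).re = lowestEnergyInSector 1 (Hxxz M u) 0 :=
    re_form_of_sectorGS 1 (torusGraph 2 M) hn he
  -- (i) `ψ₀` as a trial state at `u`
  have hvar : lowestEnergyInSector 1 (Hxxz M u) 0 ≤ (star ψ₀ ⬝ᵥ (Hxxz M u *ᵥ ψ₀)).re :=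
    sectorEnergy_le_re_form 1 (torusGraph 2 M) h₀m h₀n
  -- the pencil `H_M(u) = T + u·P`, `H_M(1) = T + P`
  have hau : (star ψ ⬝ᵥ (Hxxz M u *ᵥ ψ)).re = tu + u * pu := re_form_affine 1 (torusGraph 2 M) (-1) u ψ
  have ha₀ : (star ψ₀ ⬝ᵥ (Hxxz M u *ᵥ ψ₀)).re = t₀ + u * p₀ := re_form_affine 1 (torusGraph 2 M) (-1) u ψ₀
  have ha₁ : (star ψ₀ ⬝ᵥ (Hxxz M 1 *ᵥ ψ₀)).re = t₀ + 1 * p₀ := re_form_affine 1 (torusGraph 2 M) (-1) 1 ψ₀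
  -- (ii) `pu ≤ |E|/4`
  have hP : pu ≤ Nb / 4 * (star ψ ⬝ᵥ ψ).re := re_pencil_form_le M ψ
  rw [hn, Complex.one_re, mul_one] at hP
  -- (iii) `t₀ = E_M(0) ≤ -|E|/4`
  have hA₁ : lowestEnergyInSector 1 (Hxxz M 0) 0 ≤ -(Nb / 4) := sectorEnergy_zero_le M hM
  -- (iv) `t₀ + p₀ ≥ -|E|/4`
  have hA₂ : -(Nb / 4) ≤ (star ψ₀ ⬝ᵥ (Hxxz M 1 *ᵥ ψ₀)).re := re_form_hxxz_one_ge M hM h₀m h₀n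
  -- assemble
  rw [Complex.neg_re, Complex.neg_re]
  have hu0 : 0 ≤ -u := by linarith [hu.2]
  have e1 : 0 ≤ (-u) * (Nb / 4 - pu) := mul_nonneg hu0 (by linarith)
  have e2 : 0 ≤ (-u) * (p₀ - (-(Nb / 4) - t₀)) := mul_nonneg hu0 (by linarith)
  have e3 : 0 ≤ (-u) * (-2 * t₀ - Nb / 2) := mul_nonneg hu0 (by linarith)
  nlinarith [e1, e2, e3, hvar, hau, ha₀, hEu]

end Summit.HubbardSuperconductivity.HubbardSuperconductivity.Theorems.AnisotropyChord.DoobJohnsonChord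

end
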